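import Summits.Parity.BatemanHorn.Theorems.SelbergDelangeRigidityLSDRealSegmentEulerFactor
import Summits.Parity.BatemanHorn.Theorems.SelbergDelangeRigidityLSDRealSegmentKernelLow
import HarnessLib

/-!
# Route `SelbergDelangeRigidity`, crux `LSDRealSegment` (stmt-Parity-9770), line
# `product-anatomy-subcritical`: the crux's conclusion for every Bateman–Horn system of total degree `≤ 1`
# (helper of `stub_reconstructionUnit`)

`lsdRealSegment_of_sum_natDegree_le_one` (registered helper): the BODY of the crux
`Summit.Parity.BatemanHorn.Theses.SelbergDelangeRigidity.LSDRealSegment`, verbatim, for every Bateman–Horn system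
`f` with `Σ deg fᵢ ≤ 1` — the empty system and every single linear form `aX + b` (`a ≥ 1`, `gcd(a, b) = 1`): there is
`Λ` holomorphic on `|z| < 2` with `Λ(0) = C(f)` such that for `5/4 < y < 7/4`
`x⁻¹ (log x)^{k(1−y)} Σ_{n ≤ x} y^{Ω_f(n)} → Λ(y) D^{y−1} Γ(y)^{−k}`, i.e. the Selberg–Delange law for `y^{Ω}` along
an arithmetic progression with the constant identified.  Proof: `Λ := eulerFactor f` (`stub_eulerFactor`: holomorphy;
`eulerFactor_zero`: the pin), and the segment law is the SUM of the two landed halves — the level-`x` Type-I law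
`stub_typeI` (`TypeILawOmega`) and the beyond-level kernel law `kernelLaw_of_sum_natDegree_le_one` (`KernelLawOmega`,
constant `0` here) — through the exact split `normSum_eq_typeI_add_kernel`.
-/

open Filter Finset Polynomial
open scoped BigOperators Topology Classical

namespace Summit.Parity.BatemanHorn.Cruxes.LSDRealSegment.ProductAnatomySubcritical

open Literature.NumberTheory.Sieve
open ArithmeticFunction (cardFactors)
noncomputable section

/-- **Segment law from the two halves** at the explicit `Λ = eulerFactor f`: `TypeILawOmega k f y` and
`KernelLawOmega k f y` add up, through the exact split `M_x = T_x + K_x` (`normSum_eq_typeI_add_kernel`), to the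
crux's normalised limit with constant `λ_F(y) D^{y−1} Γ(y)^{−k}`. [folklore] -/
theorem segmentLaw_of_typeI_of_kernel {k : ℕ} {f : Fin k → ℤ[X]} {y : ℝ}
    (hT : TypeILawOmega k f y) (hK : KernelLawOmega k f y) :
    Tendsto (fun x : ℕ => (x : ℂ)⁻¹ * Complex.exp ((k : ℂ) * (1 - (y : ℂ)) * (Real.log (Real.log x) : ℂ)) *
        ∑ n ∈ Finset.range (x + 1), (y : ℂ) ^ (∑ i, cardFactors (((f i).eval (n : ℤ)).toNat))) atTop
      (𝓝 (eulerFactor f y * Complex.exp (((y : ℂ) - 1) * (Real.log (∏ i, ((f i).natDegree : ℝ)) : ℂ)) *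
        (Complex.Gamma y)⁻¹ ^ k)) := by
  have h3 := (hT.add hK).congr fun x => (normSum_eq_typeI_add_kernel f y x).symm
  convert h3 using 2
  ring

/-- **lsdRealSegment_of_sum_natDegree_le_one** (registered helper of `stub_reconstructionUnit`, line
`product-anatomy-subcritical`): the conclusion of the crux `LSDRealSegment` for every Bateman–Horn system of
total degree `≤ 1` (the empty system; one linear form `aX + b`), unconditionally, with the explicit
`Λ = eulerFactor f`: holomorphy `stub_eulerFactor`, pin `eulerFactor_zero`, and on `5/4 < y < 7/4` the segment
law as the sum of `stub_typeI` and `kernelLaw_of_sum_natDegree_le_one`. [folklore] -/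
theorem lsdRealSegment_of_sum_natDegree_le_one : ∀ (k : ℕ) (f : Fin k → ℤ[X]), IsBatemanHornSystem f →
    (∑ i, (f i).natDegree) ≤ 1 → ∃ Λ : ℂ → ℂ, DifferentiableOn ℂ Λ (Metric.ball 0 2) ∧
      Λ 0 = (batemanHornConst f : ℂ) ∧ ∀ y : ℝ, 5 / 4 < y → y < 7 / 4 →
        Filter.Tendsto (fun x : ℕ => (x : ℂ)⁻¹ *
          Complex.exp ((k : ℂ) * (1 - (y : ℂ)) * (Real.log (Real.log x) : ℂ)) *
          ∑ n ∈ Finset.range (x + 1), (y : ℂ) ^ (∑ i, ArithmeticFunction.cardFactors (((f i).eval (n : ℤ)).toNat)))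
          Filter.atTop (nhds (Λ y * Complex.exp (((y : ℂ) - 1) *
          (Real.log (∏ i, ((f i).natDegree : ℝ)) : ℂ)) * (Complex.Gamma y)⁻¹ ^ k)) := by
  intro k f hf hdeg
  refine ⟨eulerFactor f, stub_eulerFactor k f hf, eulerFactor_zero hf, fun y hy hy' => ?_⟩
  exact segmentLaw_of_typeI_of_kernel (stub_typeI k f hf y (by linarith) (by linarith))
    (kernelLaw_of_sum_natDegree_le_one k f hf hdeg y (by linarith) (by linarith))

end

end Summit.Parity.BatemanHorn.Cruxes.LSDRealSegment.ProductAnatomySubcritical
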